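import Summits.CriticalPhenomena.PercolationContinuityZ3.Theorems.PercNearOneGluingNoHeavyPcintMemUniformGen
import Summits.CriticalPhenomena.PercolationContinuityZ3.Theorems.PercNearOneGluingNoHeavyPcintMemUniformBounds
import HarnessLib

/-!
# CriticalPhenomena/PercolationContinuityZ3 — Theorems/PercNearOneGluingNoHeavyPcintMemUniformGenBounds.lean: Collatz–Wielandt with `d`-dependent real weights on the base-`(k+1)` uniform automaton ⇒ `λ ≤ μ_τ(ℤ^d) ≤ λ'` for every `d ≥ k + 1`

Lane prim-pcint, STRUCTURE rule (prim-pcint-2 GEN 18); the base-dimension-parametric twin of …PcintMemUniformBounds (which is `k = 3`),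
for the memory-8 (base dimension 5) and higher uniform certificates.  Reuses `optValR`, `cnt_le_of_realCert`, `cnt_ge_of_realSubcert`,
`memGrowth_le_of_geometric` from …PcintMemUniformBounds.  Contents: `baseSumK` / `freshSumK`, **`sum_uistepK`**
(`Σ_{letters of ℤ^d} = base + (d − (k+1))·fresh`), **`memGrowth_le_of_ucertK` / `le_memGrowth_of_ucertK`**, the numeral wrapper
`UNumOKK` / `memGrowth_mem_Icc_of_unumK`, `cntP_uistepK_succ_real`, and for `k = 4` the letter table `lettersFive`, `baseIdx5` /
`freshIdx5`, `baseSum5_eq` / `freshSum5_eq`.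

HONEST FRAMING: bookkeeping.  No `sorry`; standard axioms.  Written by prim-pcint-2 gen 18 (prover-prim-pcint-2-g18-0), 2026-08-26.
-/

noncomputable section

open Filter Topology
open Literature.Probability.Percolation Literature.Probability.LatticeModels

namespace Summit.CriticalPhenomena.PercolationContinuityZ3.Theorems.Pcint

/-! ### Row sums of the uniform index automaton -/

section RowSum

variable {k d : ℕ}

/-- The base part of a row sum: the eight letters of `ℤ⁴`. [folklore] -/
def baseSumK (L : List (SCertRow (k + 1))) (w : ℕ → ℝ) (i : ℕ) : ℝ := ∑ a : Fin (k + 1) × Bool, optValR w (sistep L i a)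

/-- The fresh part of a row sum: the two letters of axis `3`. [folklore] -/
def freshSumK (L : List (SCertRow (k + 1))) (w : ℕ → ℝ) (i : ℕ) : ℝ := ∑ b : Bool, optValR w (sistep L i (Fin.last k, b))

/-- **Row sums in dimension `d`**: `Σ_{a ∈ letters of ℤ^d} w(succ_a i) = base_i(w) + (d − (k+1)) · fresh_i(w)` for `d ≥ k+1`. [folklore] -/
theorem sum_uistepK (L : List (SCertRow (k + 1))) (hd : k + 1 ≤ d) (w : ℕ → ℝ) (i : ℕ) :
    ∑ a : Fin d × Bool, optValR w (uistepK k L d i a) = baseSumK L w i + ((d : ℝ) - (k + 1)) * freshSumK L w i := by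
  -- per sign `b`, sum over the axis as a natural number
  let g : Bool → ℕ → ℝ := fun b j =>
    if h : j < k + 1 then optValR w (sistep L i (⟨j, h⟩, b)) else optValR w (sistep L i (Fin.last k, b))
  have hpt : ∀ (b : Bool) (j : Fin d), optValR w (uistepK k L d i (j, b)) = g b j := by
    intro b j
    simp only [uistepK, g]
    split_ifs <;> rfl
  have haxis : ∀ b : Bool, ∑ j : Fin d, optValR w (uistepK k L d i (j, b)) =
      ∑ j : Fin (k + 1), optValR w (sistep L i (j, b)) + ((d : ℝ) - (k + 1)) * optValR w (sistep L i (Fin.last k, b)) := by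
    intro b
    have h1 : ∑ j : Fin d, optValR w (uistepK k L d i (j, b)) = ∑ j ∈ Finset.range d, g b j := by
      rw [← Fin.sum_univ_eq_sum_range (fun j => g b j) d]
      exact Finset.sum_congr rfl fun j _ => hpt b j
    have h2 : ∑ j : Fin (k + 1), optValR w (sistep L i (j, b)) = ∑ j ∈ Finset.range (k + 1), g b j := by
      rw [← Fin.sum_univ_eq_sum_range (fun j => g b j) (k + 1)]
      refine Finset.sum_congr rfl fun j _ => ?_
      simp only [g, dif_pos j.isLt, Fin.eta]
    have h3 : ∑ j ∈ Finset.Ico (k + 1) d, g b j = ((d : ℝ) - (k + 1)) * optValR w (sistep L i (Fin.last k, b)) := by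
      rw [Finset.sum_congr rfl (fun j hj => by
        have hj4 : ¬ j < k + 1 := by simp [Finset.mem_Ico] at hj; omega
        show g b j = optValR w (sistep L i (Fin.last k, b))
        simp only [g, dif_neg hj4])]
      rw [Finset.sum_const, Nat.card_Ico, nsmul_eq_mul]
      congr 1
      rw [Nat.cast_sub hd]; push_cast; ring
    rw [h1, h2, ← h3, Finset.range_eq_Ico, Finset.range_eq_Ico]
    exact (Finset.sum_Ico_consecutive _ (Nat.zero_le (k + 1)) hd).symm
  rw [Fintype.sum_prod_type_right]
  simp only [haxis, Finset.sum_add_distrib, ← Finset.mul_sum]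
  unfold baseSumK freshSumK
  rw [Fintype.sum_prod_type_right]

/-- The ten letters of `ℤ⁵` in the fixed order `(0,+), (0,−), …, (4,−)`. [folklore] -/
def lettersFive : List (Fin 5 × Bool) :=
  [(0, true), (0, false), (1, true), (1, false), (2, true), (2, false), (3, true), (3, false), (4, true), (4, false)]

/-- Successor indices of row `i` over the ten letters of `ℤ⁵` (computable table). [folklore] -/
def baseIdx5 (L : List (SCertRow 5)) (i : ℕ) : List (Option ℕ) := lettersFive.map (sistep L i)

/-- Successor indices of row `i` over the two letters of axis `4`. [folklore] -/
def freshIdx5 (L : List (SCertRow 5)) (i : ℕ) : List (Option ℕ) :=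
  [sistep L i ((4 : Fin 5), true), sistep L i ((4 : Fin 5), false)]

/-- The base sum (`k = 4`) as a list sum over the successor table. [folklore] -/
theorem baseSum5_eq (L : List (SCertRow 5)) (w : ℕ → ℝ) (i : ℕ) :
    baseSumK (k := 4) L w i = ((baseIdx5 L i).map (optValR w)).sum := by
  simp only [baseSumK, Fintype.sum_prod_type, Fintype.sum_bool, Fin.sum_univ_def]
  rw [show List.finRange (4 + 1) = [0, 1, 2, 3, 4] from rfl]
  simp only [List.map, List.sum_cons, List.sum_nil, baseIdx5, lettersFive]
  ring

/-- The fresh sum (`k = 4`) as a list sum over the successor table. [folklore] -/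
theorem freshSum5_eq (L : List (SCertRow 5)) (w : ℕ → ℝ) (i : ℕ) :
    freshSumK (k := 4) L w i = ((freshIdx5 L i).map (optValR w)).sum := by
  simp only [freshSumK, Fintype.sum_bool, freshIdx5, List.map, List.sum_cons, List.sum_nil, add_zero,
    show (Fin.last 4 : Fin 5) = 4 from rfl]

/-- One step of the first-letter recursion of `cntP` on the uniform index automaton, in `ℝ`:
`cntP_{n+1}(i) = base_i(cntP_n) + (d − (k+1))·fresh_i(cntP_n)` for `d ≥ k+1`. [folklore] -/
theorem cntP_uistepK_succ_real (L : List (SCertRow (k + 1))) (hd : k + 1 ≤ d) (P : ℕ → Prop) [DecidablePred P] (i n : ℕ) :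
    (cntP (uistepK k L d) P i (n + 1) : ℝ) =
      baseSumK L (fun j => (cntP (uistepK k L d) P j n : ℝ)) i +
        ((d : ℝ) - (k + 1)) * freshSumK L (fun j => (cntP (uistepK k L d) P j n : ℝ)) i := by
  rw [← sum_uistepK L hd]
  simp only [cntP, Nat.cast_sum]
  refine Finset.sum_congr rfl fun a _ => ?_
  cases uistepK k L d i a <;> simp

end RowSum

/-! ### The uniform certificates -/

section Bounds

variable {k d : ℕ}

/-- **Uniform UPPER certificate**: `μ_τ(ℤ^d) ≤ λ` for `d ≥ k+1` from positive real row weights with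
`base_i(w) + (d − (k+1))·fresh_i(w) ≤ λ·w_i` on every row of a structurally valid dimension-`(k+1)` list supported off axis `k`.
[cite: PonitzTittmann2000, §3] -/
theorem memGrowth_le_of_ucertK [NeZero d] {τ : ℕ} {L : List (SCertRow (k + 1))} (hτ : 2 ≤ τ) (hd : k + 1 ≤ d)
    (hU : UStructK τ L) (hS : USuppK L) (w : ℕ → ℝ) (lam : ℝ) (hlam : 0 < lam)
    (hw : ∀ i < L.length, 0 < w i)
    (hrow : ∀ i < L.length, baseSumK L w i + ((d : ℝ) - (k + 1)) * freshSumK L w i ≤ lam * w i) :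
    MemoryTail.memGrowth d τ ≤ lam := by
  have h0 : 0 < L.length := hU.1
  set R : Set ℕ := {i | i < L.length}
  have hR : ∀ i ∈ R, ∀ a j, uistepK k L d i a = some j → j ∈ R := fun i hi a j hij =>
    (uistepK_some hd hU hS hi hij).1
  -- minimum weight
  obtain ⟨i₀, hi₀, hmin⟩ := (Finset.range L.length).exists_min_image w ⟨0, by simpa using h0⟩
  set m := w i₀
  have hm : 0 < m := hw i₀ (by simpa using hi₀)
  have hmle : ∀ i ∈ R, m ≤ w i := fun i hi => hmin i (Finset.mem_range.2 hi)
  have hrow' : ∀ i ∈ R, ∑ a : Fin d × Bool, optValR w (uistepK k L d i a) ≤ lam * w i := by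
    intro i hi; rw [sum_uistepK L hd w i]; exact hrow i hi
  have hcw := cnt_le_of_realCert (uistepK k L d) R hR w lam m hlam.le hmle hrow'
  refine memGrowth_le_of_geometric (C := w 0 / m) (by have := hw 0 h0; positivity) hlam fun n _ => ?_
  have h1 := hcw n 0 h0
  rw [← cnt_mstep_eq_cnt_uistepK hd hU hS n, cnt_mstep_empty_eq_memCount hτ] at h1
  rw [div_mul_eq_mul_div, le_div_iff₀ hm]
  linarith

/-- **Uniform LOWER certificate**: `λ ≤ μ_τ(ℤ^d)` for `d ≥ k+1` from positive real row weights with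
`λ·w_i ≤ base_i(w) + (d − (k+1))·fresh_i(w)` on every row. [cite: PonitzTittmann2000, §3] -/
theorem le_memGrowth_of_ucertK [NeZero d] {τ : ℕ} {L : List (SCertRow (k + 1))} (hτ : 2 ≤ τ) (hd : k + 1 ≤ d)
    (hU : UStructK τ L) (hS : USuppK L) (w : ℕ → ℝ) (lam : ℝ) (hlam : 0 < lam)
    (hw : ∀ i < L.length, 0 < w i)
    (hrow : ∀ i < L.length, lam * w i ≤ baseSumK L w i + ((d : ℝ) - (k + 1)) * freshSumK L w i) :
    lam ≤ MemoryTail.memGrowth d τ := by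
  have h0 : 0 < L.length := hU.1
  set R : Set ℕ := {i | i < L.length}
  have hR : ∀ i ∈ R, ∀ a j, uistepK k L d i a = some j → j ∈ R := fun i hi a j hij =>
    (uistepK_some hd hU hS hi hij).1
  -- maximum weight
  obtain ⟨i₁, hi₁, hmax⟩ := (Finset.range L.length).exists_max_image w ⟨0, by simpa using h0⟩
  set M := w i₁
  have hM : 0 < M := hw i₁ (by simpa using hi₁)
  have hMle : ∀ i ∈ R, w i ≤ M := fun i hi => hmax i (Finset.mem_range.2 hi)
  have hrow' : ∀ i ∈ R, lam * w i ≤ ∑ a : Fin d × Bool, optValR w (uistepK k L d i a) := by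
    intro i hi; rw [sum_uistepK L hd w i]; exact hrow i hi
  have hcw := cnt_ge_of_realSubcert (uistepK k L d) R hR w lam M hlam.le hMle hrow'
  have hw0 := hw 0 h0
  refine le_memGrowth_of_geometric_le (K := M / w 0) (ρ := lam) (by positivity) hlam fun n _ => ?_
  have h1 := hcw n 0 h0
  rw [← cnt_mstep_eq_cnt_uistepK hd hU hS n, cnt_mstep_empty_eq_memCount hτ] at h1
  rw [div_le_iff₀ (by positivity)]
  calc lam ^ n ≤ M * (MemoryTail.memCount d τ n : ℝ) / w 0 := by rw [le_div_iff₀ hw0]; linarith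
    _ = (MemoryTail.memCount d τ n : ℝ) * (M / w 0) := by ring

/-! ### Numeral certificates for a single dimension (decidable) -/

/-- Base part of a row sum with natural-number weights `V` (a list, default `0`). [folklore] -/
def baseSumNK (L : List (SCertRow (k + 1))) (V : List ℕ) (i : ℕ) : ℕ :=
  ∑ a : Fin (k + 1) × Bool, optVal (fun j => V.getD j 0) (sistep L i a)

/-- Fresh part of a row sum with natural-number weights. [folklore] -/
def freshSumNK (L : List (SCertRow (k + 1))) (V : List ℕ) (i : ℕ) : ℕ :=
  ∑ b : Bool, optVal (fun j => V.getD j 0) (sistep L i (Fin.last k, b))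

/-- **Validity of a two-sided numeral certificate in dimension `d`** on the rows of a dimension-4 list: positive weights and
`num_lo · V_i ≤ den · (base_i + (d−4) fresh_i) ≤ num_hi · V_i` for every row.  Decidable. [folklore] -/
def UNumOKK (L : List (SCertRow (k + 1))) (d numHi numLo den : ℕ) (V : List ℕ) : Prop :=
  ∀ i < L.length, 0 < V.getD i 0 ∧
    den * (baseSumNK L V i + (d - (k + 1)) * freshSumNK L V i) ≤ numHi * V.getD i 0 ∧
      numLo * V.getD i 0 ≤ den * (baseSumNK L V i + (d - (k + 1)) * freshSumNK L V i)

/-- `UNumOK` is decidable. [folklore] -/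
instance (L : List (SCertRow (k + 1))) (d numHi numLo den : ℕ) (V : List ℕ) : Decidable (UNumOKK L d numHi numLo den V) := by
  unfold UNumOKK; infer_instance

/-- Casting the base sum to `ℝ`. [folklore] -/
theorem cast_baseSumNK (L : List (SCertRow (k + 1))) (V : List ℕ) (i : ℕ) :
    ((baseSumNK L V i : ℕ) : ℝ) = baseSumK L (fun j => (V.getD j 0 : ℝ)) i := by
  simp [baseSumNK, baseSumK, cast_optVal]

/-- Casting the fresh sum to `ℝ`. [folklore] -/
theorem cast_freshSumNK (L : List (SCertRow (k + 1))) (V : List ℕ) (i : ℕ) :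
    ((freshSumNK L V i : ℕ) : ℝ) = freshSumK L (fun j => (V.getD j 0 : ℝ)) i := by
  simp [freshSumNK, freshSumK, cast_optVal]

/-- **Two-sided bound from a numeral certificate**: `num_lo/den ≤ μ_τ(ℤ^d) ≤ num_hi/den` (`d ≥ 4`, `den > 0`, `num_lo > 0`).
[cite: PonitzTittmann2000, §3] -/
theorem memGrowth_mem_Icc_of_unumK [NeZero d] {τ : ℕ} {L : List (SCertRow (k + 1))} (hτ : 2 ≤ τ) (hd : k + 1 ≤ d)
    (hU : UStructK τ L) (hS : USuppK L) {numHi numLo den : ℕ} {V : List ℕ} (hden : 0 < den) (hlo : 0 < numLo)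
    (h : UNumOKK L d numHi numLo den V) :
    (numLo : ℝ) / den ≤ MemoryTail.memGrowth d τ ∧ MemoryTail.memGrowth d τ ≤ (numHi : ℝ) / den := by
  set w : ℕ → ℝ := fun j => (V.getD j 0 : ℝ)
  have hw : ∀ i < L.length, 0 < w i := fun i hi => by
    show (0 : ℝ) < ((V.getD i 0 : ℕ) : ℝ)
    exact_mod_cast (h i hi).1
  have hdenR : (0 : ℝ) < den := by exact_mod_cast hden
  have hd4 : ((d - (k + 1) : ℕ) : ℝ) = (d : ℝ) - (k + 1) := by rw [Nat.cast_sub hd]; push_cast; ring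
  have hrowR : ∀ i < L.length,
      (numLo : ℝ) * w i ≤ (den : ℝ) * (baseSumK L w i + ((d : ℝ) - (k + 1)) * freshSumK L w i) ∧
        (den : ℝ) * (baseSumK L w i + ((d : ℝ) - (k + 1)) * freshSumK L w i) ≤ (numHi : ℝ) * w i := by
    intro i hi
    obtain ⟨-, h1, h2⟩ := h i hi
    have h1' : ((den * (baseSumNK L V i + (d - (k + 1)) * freshSumNK L V i) : ℕ) : ℝ) ≤ ((numHi * V.getD i 0 : ℕ) : ℝ) := by
      exact_mod_cast h1
    have h2' : ((numLo * V.getD i 0 : ℕ) : ℝ) ≤ ((den * (baseSumNK L V i + (d - (k + 1)) * freshSumNK L V i) : ℕ) : ℝ) := by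
      exact_mod_cast h2
    simp only [Nat.cast_mul, Nat.cast_add, hd4, cast_baseSumNK, cast_freshSumNK] at h1' h2'
    exact ⟨h2', h1'⟩
  have hloR : (0 : ℝ) < numLo := by exact_mod_cast hlo
  have hhiR : (0 : ℝ) < numHi := by
    have h0 := hU.1
    obtain ⟨h2, h1⟩ := hrowR 0 h0
    have hw0 := hw 0 h0
    have : (0 : ℝ) < (numHi : ℝ) * w 0 := by nlinarith
    by_contra hc
    push Not at hc
    nlinarith
  constructor
  · refine le_memGrowth_of_ucertK hτ hd hU hS w _ (div_pos hloR hdenR) hw fun i hi => ?_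
    have := (hrowR i hi).1
    rw [div_mul_eq_mul_div, div_le_iff₀ hdenR]
    linarith
  · refine memGrowth_le_of_ucertK hτ hd hU hS w _ (div_pos hhiR hdenR) hw fun i hi => ?_
    have := (hrowR i hi).2
    rw [div_mul_eq_mul_div, le_div_iff₀ hdenR]
    linarith

end Bounds

end Summit.CriticalPhenomena.PercolationContinuityZ3.Theorems.Pcint
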